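import Summits.HodgeConjecture.HodgeConjecture.Theorems.F0P6bWeilCartierDuality
import Literature.AlgebraicGeometry.Motives.AbelianVarietyFrobeniusBlockLagrangian   -- ★ p850276 = the generic re-home of `Lines/F0_P6b_FrobeniusLagrangian.lean` ((BLF) letter `BlockLagrangianFrobenius`, `blockLagrangianFrobenius_holds`)
import Literature.AlgebraicGeometry.GroupSchemes.TorsionLayerBlockIdempotents
import Literature.AlgebraicGeometry.Motives.AbelianVarietyTorsionFrobeniusPins
import Literature.AlgebraicGeometry.AbelianSchemes.DualPairDimEq
import Literature.AlgebraicGeometry.AbelianSchemes.PolarizationUnitHypothesis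
import Literature.AlgebraicGeometry.AbelianSchemes.DualIsogenyDegree
import Literature.AlgebraicGeometry.AbelianSchemes.SerreTwistBaseChange          -- ★ `DualPair.baseChangeHom_dualIsogenyOver_base`, `Polarization.baseChange`, `DualPair.baseChange`
import Literature.AlgebraicGeometry.AbelianSchemes.AbelianSchemeFixedPowBaseChange -- ★ `RingAction.baseChange`, `RingAction.baseChange_i`
import Literature.AlgebraicGeometry.AbelianSchemes.PolarizationPrimeToPTorsion     -- ★ GEN leaf (o1) `comp_lam_eq_one_imp_eq_one_of_coprime` (degree-prime-to-`p` currency)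
import Literature.AlgebraicGeometry.GroupSchemes.CartierDualAnnihilatorByRank    -- ★ annihilator by rank (points form) — ED. 4 §6.7
import Literature.AlgebraicGeometry.GroupSchemes.PreimageRankOfLiftable         -- ★ p849894∕p849907 (LA3-p03 (g3)): rank of a preimage, `liftable_of_cover` — ED. 4 §6.8
import Literature.AlgebraicGeometry.AbelianSchemes.SerreTensorIsogeny            -- ★ `RingAction.i_natCast` — ED. 4 §6.8
import Literature.AlgebraicGeometry.GroupSchemes.BTGroupUniformizerKernelRank   -- ★ `Alg.finrank_eq_of_iso`, `exists_iso_of_fac_of_fac` — ED. 4 §6.8 (γ) seam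
import HarnessLib

/-!
# `F0P6bWDock` — ★ RE-HOME (rung-0 re-homing task, books INVENTORY §8.4 M-3; LEAD F0P6-plan (g4) «M-72») of the crux workfile `Lines/F0_P6b_WDock.lean`

**SIZE-LINT SPLIT ×4** (`Theorems/` files with proofs are ≤ 400 lines): PART 1 of 4 — §1 the package `WDockPackage`, §2 currency lemmas, §2b the (D-P) seam, §3 the head `wDockPackage_of_line`. Parts: `Theorems/F0P6bWDockPackage.lean` → `…/F0P6bWDockWBlockLaw.lean` → `…/F0P6bWDockSeams.lean` → `…/F0P6bWDock.lean`, each importing the previous; same namespace throughout; the options∕`open` preamble is repeated verbatim in each part.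

This `Theorems/` module is the TREE BYTES of `Summits/HodgeConjecture/HodgeConjecture/Cruxes/HLiu418/Lines/F0_P6b_WDock.lean` (edition of record,
tree sha16 7d61e77295a90030, 1222 l., code-`sorry`-free) with the NAMESPACE KEPT — `Summit.HodgeConjecture.HodgeConjecture.Cruxes.HLiu418.F0P6bWDock` — so that every
fully-qualified name (`WDockPackage`, `mulN_eq_zsmul_id`, `relFrobenius_toAbelianVariety_eq`, `eq_one_of_comp_mulN_of_comp_lam`, `baseChange_lam_comp_eq_mulN`, `eq_one_of_comp_mulN_of_comp_lam_of_kerRank_coprime`, `wDockPackage_of_line`, `rosati_baseChange`, `wDockPackage_of_baseChange`, `wDockPackage_of_baseChange_of_hlam`, …; 41 declarations) is UNCHANGED; only this module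
docstring is re-headed and the `Lines` imports are switched to their ★ re-homed twins (`F0_P6b_WeilCartierDuality` → ★ `Theorems.F0P6bWeilCartierDuality` p850288∕p850306∕#8C, namespace kept; `F0_P6b_FrobeniusLagrangian` → ★ `Literature.AlgebraicGeometry.Motives.AbelianVarietyFrobeniusBlockLagrangian` p850276, whose old namespace՚s one `open` line is renamed — the only non-import code-line change).  Why a re-home: a `Theorems/` file cannot import a `Lines/` workfile (F0P6-ref1 o-6), and closing
stmt-HodgeConjecture-24832 `--as proved --by <Theorems decl>` at rung 0 needs the sorry-free Lines chain behind the gate (RE-HOME MAP v1.1, LA7-plan (g4),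
2026-09-02; director g27 s1336 (R1)–(R3)).    Lines importers of the original: none.
After this file is ★ the Lines workfile is meant to become a one-import SHIM of it (a `Lines/` write, batched per cone on the LEAD's word), so no
environment ever holds two copies (NO-CROSS-IMPORT rule, «M-72» (3)).  It asserts nothing beyond what the workfile already proves.

## Original module docstring (verbatim)
# F0 ∕ P6b — THE `w`-BLOCK DOCK (ED. 1): the P6b pair (W-line ⊕ (BLF)) delivered as ONE named package in the dock currency
# ED. 4 (F0P6b-plan (g5) cand, ADD-ONLY over ED. 3 «3′» 9a8d7b985032b497): NEW §6.6 `namespace WBlockLawED4b` (organ (ii): the socket (E) from ONE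
# inclusion + a rank equality — `heart_of_le_of_finrank_eq`, `heart_of_ge_of_finrank_eq`, `heart_of_points`, `law_w_of_le`, `law_w_of_ge`, `law_w_of_points`)
# and §6.7 `namespace WBlockLawED4c` (organ (iii): the socket (KW) from isotropy + complementary rank — `finrank_alg_W_eq`, `hKW_of_isotropy_of_finrank`,
# `hKW_of_isotropy_of_finrank'`); new imports ★ `CartierDualAnnihilatorByRank` (§6.7), ★ `PreimageRankOfLiftable` + ★ `SerreTensorIsogeny` (§6.8); every ED. 3 byte above §6.6 unchanged; 0 `sorry`, 0 socket.
# and §6.8 `namespace WBlockLawLA3` (organ (iv) = «L3» LA3-p03 (g3)'s HOME pack `F0P6bWDockShiftedKernelRank.v1` 28b71d69db1efa89 VERBATIM: (I-rk) reduced to the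
# ϖ-layer count — `exists_shiftHom`, `isMonHom_shiftHom`, `liftable_shiftHom`, `preimage_points_iff`, `finrank_shiftedKernel_mul_finrank_layer`, `hrk_of_layer_count`,
# and its v2 §4 «(γ) seam» `layer_points_iff`, `nonempty_layer_iso`, `finrank_layer_eq` (pack v2 2e346740a3caebf6); imports ★ `PreimageRankOfLiftable`, ★ `SerreTensorIsogeny`, ★ `BTGroupUniformizerKernelRank`).

Cell `hodgecm-mathlib`, FLOOR 0, sub-desk P6b «BT groups & Serre–Tate ∕ Lubin–Tate» (MOD-PLAN v0.9 Row 4), crux workfile on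
`stmt-HodgeConjecture-24832` (HLiu418), route `HCCMUnconditional`.  SORRY-FREE.  No `instance`, no `notation`.

## What this file is for
The special-fibre Frobenius-kernel law (rL) of `Roof₀` (`Lines/F0_P6a_ModuliDatumDefs.lean` ED. 3, field `frob₀.quot₀_roof`) is proved
BLOCK-WISE along the CRT idempotents of `𝒪_F ∕ q` (★ `Motives/AbelianVarietyKernelLawBlockAssembly` = (E2-asm)): the connected `w`-block and the
banal blocks are ★ organs ((C1) `AbelianSchemes/TorsionBlockEtaleOfLieSignature`, `GroupSchemes/CartierDualBlockDuality`), and the `c • w`-BLOCK —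
the block `W = A[q]·ε̄` Cartier-dual to the connected block `𝒢 = A[q]·ε` — is P6b's: the tree lines
`Lines/F0_P6b_WeilCartierDuality.lean` ED. 3 (the NAMED Hermitian Lagrangian duality `e₀ : A[q] ≅ A[q]^D`, §5; `dim Â = dim A` internal since ED. 3, ★ `DualPair.dim_hat_eq`) and
`Lines/F0_P6b_FrobeniusLagrangian.lean` ED. 1 ((BLF) `blockLagrangianFrobenius_holds`) give, docked on one another with zero glue (junction v6),
the `W`-block duality `eW : W ≅ 𝒢^D` and the LAW «a point `x` of `W` is killed by `F^{(r)}_{A∕k}` iff it lies in the `eW`-annihilator of `𝒢 ∩ Ker F^{(r)}`».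

This file packages that output, WITH ITS PINS DISCHARGED, as ONE `Prop` `WDockPackage` (the idiom of the spine's `DockPackage`, `Lines/F0_P6a_RGDAssembly.lean`
ED. 2: one `∃`-statement elaborated once, consumed by one `obtain`) and proves it — `wDockPackage_of_line` — from exactly the inputs the RGD datum carries at a
special point `x̄`: an abelian scheme `A` over `Spec k` (`k` perfect of characteristic `p`; at `x̄`, `k = κ̄(w)`), a ring action `act : RingAction O A`
(★ `AbelianSchemeOverRingAction`), a dual pair `D` and a polarisation `pol` (★ `AbelianSchemeDualPair`, ★ `AbelianSchemePolarization`), a ring involution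
`star` of `O` with the ROSATI adjunction `ι(ā) ≫ λ = λ ≫ ι(a)^∨` (the spine's `RGDInputsAt.rosati`), `λ` injective on `A[q]` (`hlam`, the polarisation is prime
to `p` at `x̄`), and ONE element `εu ∈ O` idempotent modulo `q = p ^ r` (the CRT lift cutting out the `w`-block; `ε̄ := star εu` cuts out the `c • w`-block).
Everything else is discharged here BY NAME: the torsion pin `A[q] ↪ A` and the Frobenius-kernel pin `A[q] ∩ Ker F^{(r)} ↪ A[q]` (★ (α′)
`AbelianVarietyTorsionFrobeniusPins.exists_torsion_frobeniusKernel_pins`), the dual pin `Â[q] ↪ Â` (★ `exists_torsionPin`), the layer action `β` of `O` on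
`A[q]` with its idempotency at `εu`, `ε̄` (★ (α) `TorsionLayerBlockIdempotents`: `exists_layerEnd_abelianVariety`, `layerEnd_add`, `layerEnd_mul`,
`layerEnd_idem_of_mul_self_eq`, `mul_self_eq_add_nsmul_star`), the fixed layers `W`, `𝒢` and the sublayer `𝒢 ∩ Ker F` (★ `exists_fixedLayer`,
`exists_interLayer_of_reading`) and the unit normalisation of the Poincaré sheaf (★ `Polarization.nonempty_unitHatSlice_iso`).

## Currency (the seam with the spine, stated once)
* `A : AbelianSchemeOver (Spec (.of k))` and the abelian variety `A.toAffine.toAbelianVariety` have the same carrier and group law on the nose (★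
  `AbelianSchemeOverField.toAbelianVariety_X`, `ofAbelianVariety_toAbelianVariety`, ★ `AbelianSchemeOverBase.toOver_toAffine`, all `rfl`); at `x̄` the spine's
  `fibre₀Of … x̄` IS `(sch₀Of … x̄).toAffine.toAbelianVariety`.
* Frobenius: `(A.toAffine.toAbelianVariety.relFrobenius p r).hom.hom.hom = relFrobeniusOver p r A.X` (★ `relFrobenius_hom_hom_hom`, `rfl`) — the (rL) token.
* Torsion: the pins read `t ≫ ((q : ℤ) • 𝟙 A.toAffine.toAbelianVariety).hom.hom.hom = 1`; `mulN_eq_zsmul_id` below converts to `A.mulN q` (the `Roof₀` token).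
* Endomorphisms: `ι(a)` as a morphism of abelian varieties is ★ `homOfIsMonHom (act.i a)` (`DualIsogenyDegree`), with `(homOfIsMonHom (act.i a)).hom.hom.hom = act.i a`
  by `rfl` (★ `homOfIsMonHom_hom`); the spine's `act₀Of` is the same term at `x̄` (P6d seam).

## How the spine consumes it (one `obtain`; instantiation at a special point `x̄`)
```
obtain ⟨G, _, _, _, _, _, j, _, _, hG, Φ, _, _, _, _, _, φ, _, _, hΦ, Ĝ, _, _, _, _, _, ĵ, _, _, hĜ,
    β, hβm, hβ, hβone, hβadd, hβmul, hN, hidem𝒢, hidemW, hlamG,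
    W, _, _, _, _, _, jW, _, _, hW, 𝒢l, _, _, _, _, _, j𝒢, _, _, h𝒢, Φ𝒢, _, _, _, _, _, φ𝒢, _, _, hΦ𝒢,
    eW, heW, he₀, hherm, hlag, hdock, hlaw⟩ :=
  wDockPackage_of_line p r A D pol star hstar act hRos hlam εu c he
```
with (D-0) `k := κ̄(w)` (`geomResidueField w`), `p := I.pChar`, `r := I.fDeg` (`haveI : Fact p.Prime := ⟨I.hpChar.1⟩`, `I.charP₀`); (D-A) `A := sch₀Of 𝓜 w I.univ x̄`,
`D := dual₀Of …`, `pol := pol₀Of …`; (D-ι) `act :=` the base change of `I.act` to `x̄` (★ `RingAction.baseChange` twice; the spine's `act₀Of … a x̄` is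
`homOfIsMonHom (act.i a)` up to the P6d seam); (D-ε) `O := 𝓞 F`, `star := NumberField.RingOfIntegers.mapRingHom (complexConj F)` (Mathlib), `hstar` from
`complexConj` being an involution, `εu` a CRT element with `εu ≡ 1 (mod 𝔭_w^N)`, `εu ≡ 0 (mod 𝔭_{c•w}^N ⋯)`, `εu² − εu ∈ (q)` (★ `TorsionLayerBlockIdempotents` §3 /
Mathlib `IsDedekindDomain.exists_forall_sub_mem_ideal`); (D-R) `hRos` = `I.rosati b (star b) (by simp)` base-changed to `x̄` — PRE-PAID in §4: hop with `rosati_baseChange ιs …` and read the head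
`wDockPackage_of_baseChange … x̄.left` (GEN՚s currency `(I.univ.baseChange ιs).baseChange x̄.left` on the nose); (D-P) `hlam` = «`λ_x̄` is injective on
`A_x̄[q]`» (the polarisation of the tuple is prime to `p`: [Liu2021] Rem. C.13 (p. 112) • «`λ` is a `p`-principal polarization of `(A, i)`»; Def. C.19 (pp. 116–117)) — PRE-PAID in §2b in two currencies:
(P-1) the UPSTAIRS quasi-inverse row `pol.lam ≫ ν = univ.mulN d`, `ν` a homomorphism, `p ∤ d` (base-change stable; read by the head `wDockPackage_of_baseChange`,
which then has NO point-wise hypothesis at all), (P-2) ★ GEN leaf (o1) degree currency at the point (`eq_one_of_comp_mulN_of_comp_lam_of_kerRank_coprime`).  The conclusion's Frobenius token is converted to (rL)'s `relFrobeniusOver p r (sch₀Of …).X` by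
`relFrobenius_toAbelianVariety_eq` (`rfl`), its torsion token to `mulN` by `mulN_eq_zsmul_id`; the `w`-block LAW `hlaw` is the `law_i` of ★ (E2-asm)
`comp_relFrobenius_eq_one_iff_of_blocks` for the `c • w`-block once `ann_{eW}(Φ𝒢)` is read as «killed by `ι(𝔠) ≫ q̄`» through `hdock` + the (iso) law
`polarisedIsogenyKernelIsotropic_holds` (W-line §6) AT THE SAME `e₀ p r A.toAffine.toAbelianVariety D pol j hG ĵ hĜ hlamG` + ★ (β) `CartierDualAnnihilatorByRank` +
the block ranks of `Lines/F0_P6b_BlockNumerics.lean` (RGD-internal step (E2-DOCK-W)).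

ED. 3 (additive, sorry-free): §6 `WBlockLaw` — the `w`-block section (rL-w) of the Frobenius-kernel law: `rlw_shift` (the arithmetic level shift on `W`, any shift
element `s`; `rlw_shift_natCast` for `s = p^{r−1}`), the token lemmas `layerEnd_natCast`∕`comp_comp_zsmul_id`, `exists_annihilator_iff_of_factor`, and the HEAD `rL_W`∕`rL_W'`
(«`x ≫ F^{(r)} = 1 ↔ ∀ a ∈ 𝔠, x ≫ ι(a) ≫ q̄ = 1` on the `w`-block») over the ROOF road՚s sockets (KW) kernel reading of `q̄` on `W` in dock currency (or (KW₀) in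
`e₀`-currency via `kw_of_dock` and the docking law (iv)), (E) HEART-FROB′ on the `c•w`-layer, two arithmetic rows and `hqβ` — the (E2-DOCK-W) step typed and paid.

ED. 4 (additive, sorry-free): §6.4 `WBlockLaw.hqβ_of_descends`∕`hqβ_of_roof4` — the socket `hqβ` PAID from `Roof₀` (r4₀) («`ι(a)` descends along `q̄` to a bare
endomorphism of `B̄`»; the unit is fixed because `q̄`, `ι(a)` are homomorphisms); §6.5 `WBlockLaw.law_w` — `rL_W'` in the `law`-binder currency of ★ (rL-asm)
`AbelianSchemes/FrobeniusKernelLawBlockAssembly.comp_relFrobeniusOver_eq_one_iff_of_torsion_blocks` («`x ≫ A.mulN q = 1 → x ≫ ι(ē) = x → (x ≫ relFrobeniusOver p r A.X = 1 ↔ …)`»,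
tokens `mulN_eq_zsmul_id` + `rfl`), so the ROOF road՚s (rL) preamble feeds the `w`-index by ONE `exact`.

HC_CM is proved only modulo the printed citations until rung 0 closes; this file changes no count (it has no `sorry` and no socket).

References: [MumfordAV1970] §13 Cor. 3 (p. 130), §15 Thm. 1 (p. 143), §19, §20 (I) (p. 186), §23; [Oda1969] Cor. 1.3; [Tate1997FiniteFlatGroupSchemes] §(3.7);
[Tate1967] §2.2; [GortzWedhorn2020] Def. 4.45 (2) (p. 117); [RapoportSmithlingZhang2020Diagonal] §4.3 (4.23) (p. 21); [Liu2021] Prop. D.8 (3), pp. 135–138.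
-/

set_option autoImplicit false
set_option linter.dupNamespace false

-- Mathlib's `Over`/`Scheme` APIs are stated across semireducible wrappers (as in the two P6b Lines modules imported here).
set_option backward.isDefEq.respectTransparency false

noncomputable section

universe u

open CategoryTheory CategoryTheory.Limits AlgebraicGeometry MonoidalCategory CartesianMonoidalCategory
open scoped MonObj
open Literature.AlgebraicGeometry.GroupSchemes Literature.AlgebraicGeometry.GroupSchemes.GroupSchemeKernel
open Literature.AlgebraicGeometry.GroupSchemes.AffineGroupScheme Literature.AlgebraicGeometry.GroupSchemes.TorsionLayer
open Literature.AlgebraicGeometry.Motives Literature.AlgebraicGeometry.Motives.AbelianVariety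
open Literature.AlgebraicGeometry.AbelianSchemes Literature.AlgebraicGeometry.AbelianSchemes.AbelianSchemeOver
open Literature.AlgebraicGeometry.AbelianSchemes.AbelianSchemeOver.DualPair
open Summit.HodgeConjecture.HodgeConjecture.Cruxes.HLiu418.F0P6bWeilCartierDuality
open Literature.AlgebraicGeometry.Motives.AbelianVarietyFrobeniusBlockLagrangian   -- (BLF)՚s ★ namespace (was `…Cruxes.HLiu418.F0P6bFrobeniusLagrangian`)

namespace Summit.HodgeConjecture.HodgeConjecture.Cruxes.HLiu418.F0P6bWDock


/-! ## §1 THE PACKAGE (one `Prop`, the spine's `DockPackage` idiom) -/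

/-- **THE `w`-BLOCK DOCK PACKAGE at `q = p ^ r`** for `(A, act, D, pol, star, εu)` over a perfect field `k` of characteristic `p`: there exist
— the torsion pin `j : G = A[q] ↪ A` (reading `t ∈ G ↔ t ≫ (q • 𝟙 A) = 1`) and the Frobenius-kernel pin `φ : Φ = G ∩ Ker F^{(r)} ↪ G`;
— the dual pin `ĵ : Ĝ = Â[q] ↪ Â`;
— the layer action `β : O → End G` (`β a ≫ j = j ≫ ι(a)`, homomorphisms) with its calculus (`β 1 = 𝟙`, `β(a+b) = β a · β b`, `β(ab) = β b ≫ β a`,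
  `[q]_G = 1`, `β(εu)`, `β(ε̄)` idempotent — the inputs of ★ (E2-asm) §B on `G`) and the fact `λ` injective on `G`;
— the fixed layers `jW : W = Fix β(ε̄) ↪ G` (`ε̄ = star εu`, the `c • w`-block) and `j𝒢 : 𝒢l = Fix β(εu) ↪ G` (the `w`-block), and the sublayer
  `φ𝒢 : Φ𝒢 = 𝒢l ∩ Ker F^{(r)} ↪ 𝒢l` (reading `y ∈ Φ𝒢 ↔ ((y ≫ j𝒢) ≫ j) ≫ F^{(r)} = 1`);
— the `W`-BLOCK DUALITY `eW : W ≅ 𝒢l^D`, a homomorphism,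
such that, for THE NAMED duality `e₀ = e₀ p r A D pol j hG ĵ hĜ hlamG : G ≅ G^D` of the W-line (§5 of `Lines/F0_P6b_WeilCartierDuality.lean` ED. 3):
`e₀` is a homomorphism, HERMITIAN for `β` (`β(ā) ≫ e₀ = e₀ ≫ β(a)^D`), LAGRANGIAN on `Φ` (`ann_{e₀}(Φ) = Φ`), docks `eW` (`jW ≫ e₀ ≫ j𝒢^D = eW`), and
**THE `w`-BLOCK FROBENIUS LAW** holds: a `T`-point `x` of `W` lies in the `eW`-annihilator of `Φ𝒢` iff `((x ≫ jW) ≫ j) ≫ F^{(r)}_{A∕k} = 1`.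
All instance blocks are the ones (BLF) quantifies over (`GrpObj ∕ IsCommMonObj ∕ IsAffine ∕ Module.Free ∕ Module.Finite ∕ IsMonHom ∕ IsClosedImmersion`).
[cite: MumfordAV1970, §20 (I) (p. 186), §23] [cite: Oda1969, Cor. 1.3] [cite: Tate1997FiniteFlatGroupSchemes, §(3.7)] -/
def WDockPackage (k : Type u) [Field k] [PerfectField k] (p r : ℕ) [Fact p.Prime] [CharP k p]
    (A : AbelianSchemeOver (Spec (.of k))) (D : A.DualPair) (pol : A.Polarization D)
    {O : Type} [CommRing O] (star : O →+* O) (act : A.RingAction O) (εu : O) : Prop :=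
  ∃ (G : SchemeOver k) (_ : GrpObj G) (_ : IsCommMonObj G) (_ : IsAffine G.left) (_ : Module.Free k (Alg G)) (_ : Module.Finite k (Alg G))
    (j : G ⟶ A.X) (_ : IsMonHom j) (_ : IsClosedImmersion j.left)
    (hG : ∀ ⦃T : SchemeOver k⦄ (t : T ⟶ A.X),
      (∃ s : T ⟶ G, s ≫ j = t) ↔ t ≫ ((((p ^ r : ℕ) : ℤ) • 𝟙 A.toAffine.toAbelianVariety).hom.hom.hom) = 1)
    (Φ : SchemeOver k) (_ : GrpObj Φ) (_ : IsCommMonObj Φ) (_ : IsAffine Φ.left) (_ : Module.Free k (Alg Φ)) (_ : Module.Finite k (Alg Φ))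
    (φ : Φ ⟶ G) (_ : IsMonHom φ) (_ : IsClosedImmersion φ.left)
    (_ : ∀ ⦃T : SchemeOver k⦄ (t : T ⟶ G),
      (∃ s : T ⟶ Φ, s ≫ φ = t) ↔ (t ≫ j) ≫ (A.toAffine.toAbelianVariety.relFrobenius p r).hom.hom.hom = 1)
    (Ĝ : SchemeOver k) (_ : GrpObj Ĝ) (_ : IsCommMonObj Ĝ) (_ : IsAffine Ĝ.left) (_ : Module.Free k (Alg Ĝ)) (_ : Module.Finite k (Alg Ĝ))
    (ĵ : Ĝ ⟶ D.hat.X) (_ : IsMonHom ĵ) (_ : IsClosedImmersion ĵ.left)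
    (hĜ : ∀ ⦃T : SchemeOver k⦄ (t : T ⟶ D.hat.X),
      (∃ s : T ⟶ Ĝ, s ≫ ĵ = t) ↔ t ≫ ((((p ^ r : ℕ) : ℤ) • 𝟙 D.hat.toAffine.toAbelianVariety).hom.hom.hom) = 1)
    (β : O → (G ⟶ G)) (_ : ∀ a, IsMonHom (β a)) (_ : ∀ a, β a ≫ j = j ≫ act.i a)
    -- the layer calculus of `β` (★ (α)): unital, additive, (anti-)multiplicative, `[q]_G = 1`, and the two block idempotents
    (_ : β 1 = 𝟙 G) (_ : ∀ a b, β (a + b) = β a * β b) (_ : ∀ a b, β (a * b) = β b ≫ β a) (_ : (𝟙 G) ^ (p ^ r) = 1)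
    (_ : β εu ≫ β εu = β εu) (_ : β (star εu) ≫ β (star εu) = β (star εu))
    (hlamG : ∀ ⦃T : SchemeOver k⦄ (t : T ⟶ G), (t ≫ j) ≫ pol.lam = 1 → t = 1)
    (W : SchemeOver k) (_ : GrpObj W) (_ : IsCommMonObj W) (_ : IsAffine W.left) (_ : Module.Free k (Alg W)) (_ : Module.Finite k (Alg W))
    (jW : W ⟶ G) (_ : IsMonHom jW) (_ : IsClosedImmersion jW.left)
    (_ : ∀ ⦃T : SchemeOver k⦄ (x : T ⟶ G), (∃ s : T ⟶ W, s ≫ jW = x) ↔ x ≫ β (star εu) = x)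
    (𝒢l : SchemeOver k) (_ : GrpObj 𝒢l) (_ : IsCommMonObj 𝒢l) (_ : IsAffine 𝒢l.left) (_ : Module.Free k (Alg 𝒢l))
    (_ : Module.Finite k (Alg 𝒢l)) (j𝒢 : 𝒢l ⟶ G) (_ : IsMonHom j𝒢) (_ : IsClosedImmersion j𝒢.left)
    (_ : ∀ ⦃T : SchemeOver k⦄ (x : T ⟶ G), (∃ s : T ⟶ 𝒢l, s ≫ j𝒢 = x) ↔ x ≫ β εu = x)
    (Φ𝒢 : SchemeOver k) (_ : GrpObj Φ𝒢) (_ : IsCommMonObj Φ𝒢) (_ : IsAffine Φ𝒢.left) (_ : Module.Free k (Alg Φ𝒢))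
    (_ : Module.Finite k (Alg Φ𝒢)) (φ𝒢 : Φ𝒢 ⟶ 𝒢l) (_ : IsMonHom φ𝒢) (_ : IsClosedImmersion φ𝒢.left)
    (_ : ∀ ⦃T : SchemeOver k⦄ (y : T ⟶ 𝒢l),
      (∃ s : T ⟶ Φ𝒢, s ≫ φ𝒢 = y) ↔ ((y ≫ j𝒢) ≫ j) ≫ (A.toAffine.toAbelianVariety.relFrobenius p r).hom.hom.hom = 1)
    (eW : W ≅ cartierDual 𝒢l) (_ : IsMonHom eW.hom),
    -- the four laws AT THE NAMED `e₀`
    IsMonHom (e₀ p r A.toAffine.toAbelianVariety D pol j hG ĵ hĜ hlamG).hom ∧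
    (∀ a : O, β (star a) ≫ (e₀ p r A.toAffine.toAbelianVariety D pol j hG ĵ hĜ hlamG).hom =
      (e₀ p r A.toAffine.toAbelianVariety D pol j hG ĵ hĜ hlamG).hom ≫ cartierDualMap (β a)) ∧
    (∀ ⦃T : SchemeOver k⦄ (x : T ⟶ G),
      (∃ c : T ⟶ annihilator φ, c ≫ (annihilatorι φ ≫ (e₀ p r A.toAffine.toAbelianVariety D pol j hG ĵ hĜ hlamG).inv) = x) ↔
        ∃ s : T ⟶ Φ, s ≫ φ = x) ∧
    jW ≫ (e₀ p r A.toAffine.toAbelianVariety D pol j hG ĵ hĜ hlamG).hom ≫ cartierDualMap j𝒢 = eW.hom ∧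
    ∀ ⦃T : SchemeOver k⦄ (x : T ⟶ W),
      (∃ c : T ⟶ annihilator φ𝒢, c ≫ (annihilatorι φ𝒢 ≫ eW.inv) = x) ↔
        ((x ≫ jW) ≫ j) ≫ (A.toAffine.toAbelianVariety.relFrobenius p r).hom.hom.hom = 1

/-! ## §2 CURRENCY LEMMAS (the seam with the spine's `Roof₀` tokens) -/

section Currency

variable {k : Type u} [Field k] (A : AbelianSchemeOver (Spec (.of k)))

/-- `[N]_A = (N • 𝟙 A)` — the `AbelianSchemeOver.mulN` token of `Roof₀` is the torsion-pin token of the package (★ `mulN_def`, ★ `hom_zsmul_id`).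
[cite: MumfordAV1970, §4 Cor. 1 (p. 43)] -/
theorem mulN_eq_zsmul_id (N : ℕ) : A.mulN N = (((N : ℤ) • 𝟙 A.toAffine.toAbelianVariety).hom.hom.hom) := by
  rw [AbelianSchemeOver.mulN_def, AbelianVariety.hom_zsmul_id, zpow_natCast]
  rfl

/-- The relative Frobenius of the abelian variety `A.toAffine.toAbelianVariety` IS `relFrobeniusOver p r A.X` (the (rL) token), definitionally.
[cite: SGA3I, VII_A 4.1] -/
theorem relFrobenius_toAbelianVariety_eq (p : ℕ) [ExpChar k p] (r : ℕ) :
    (A.toAffine.toAbelianVariety.relFrobenius p r).hom.hom.hom = relFrobeniusOver p r A.X := rfl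

end Currency

/-! ## §2b THE (D-P) SEAM PRE-PAID: «a polarisation prime to `p` kills no point of `A[p^r]`» — the binder `hlam` of the head, in two currencies

(P-1) QUASI-INVERSE currency (elementary, base-change stable): `λ ≫ ν = [d]_A` with `d` prime to `p` — a point `t` killed by `[p^r]` and by `λ` is
killed by `[d]`, hence by `[gcd(p^r, d)] = [1]` (Mathlib `pow_gcd_eq_one`); and the equation `λ ≫ ν = [d]` base-changes (★ `baseChangeHom_mulN`), so the
UPSTAIRS row «`λ` is `p`-principal: `∃ d ν, p ∤ d ∧ λ ≫ ν = [d]`» ([Liu2021] Rem. C.13 • «`λ` is a `p`-principal polarization of `(A, i)`», p. 112, and Def. C.19 pp. 116–117; [RapoportSmithlingZhang2020Diagonal]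
§4.1) is all GEN needs — §4 reads it.  (P-2) DEGREE currency at the point: ★ GEN leaf (o1) `comp_lam_eq_one_imp_eq_one_of_coprime`
(`IsIsogeny λ`, `kerRank λ` prime to `p`), re-keyed from `G`-points to `A`-points through a torsion pin. -/

section PrimeToP

variable {S : Scheme.{u}} (A : AbelianSchemeOver S) (D : A.DualPair)

/-- **(P-1) `[N] t = 1 ∧ λ t = 1 ⟹ t = 1` when `λ ≫ ν = [d]` with `gcd(N, d) = 1`** (any base; `t ≫ [d] = t ≫ λ ≫ ν = 1`, then Bezout on the group of
`T`-points, Mathlib `pow_gcd_eq_one`; `ν` a homomorphism so that `1 ≫ ν = 1`). [cite: MumfordAV1970, §6 Application 3 (p. 64)] [cite: Liu2021, Rem. C.13 (p. 112); Def. C.19 (pp. 116–117)] -/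
theorem eq_one_of_comp_mulN_of_comp_lam (lam : A.X ⟶ D.hat.X) {N d : ℕ} (hNd : N.Coprime d)
    (ν : D.hat.X ⟶ A.X) [IsMonHom ν] (hν : lam ≫ ν = A.mulN d) ⦃T : Over S⦄ (t : T ⟶ A.X)
    (hN : t ≫ A.mulN N = 1) (hlam : t ≫ lam = 1) : t = 1 := by
  have hd : t ≫ A.mulN d = 1 := by rw [← hν, ← Category.assoc, hlam, MonObj.one_comp]
  rw [AbelianSchemeOver.mulN_def, MonObj.comp_pow, Category.comp_id] at hN hd
  have h := pow_gcd_eq_one.2 ⟨hN, hd⟩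
  rwa [Nat.Coprime.gcd_eq_one hNd, pow_one] at h

/-- **(P-1) the quasi-inverse equation base-changes**: `λ ≫ ν = [d]_A` over `S` gives `λ_{S′} ≫ ν_{S′} = [d]_{A_{S′}}`, `ν_{S′} = (Over.pullback g).map ν`
(no homomorphism hypothesis on `ν` needed; ★ `Polarization.baseChange_lam` `rfl`, ★ `baseChangeHom_mulN`). [cite: GortzWedhorn2020, Section (4.7), (4.7.1) (p. 108)] [cite: MumfordAV1970, §6 Application 3 (p. 64)] -/
theorem baseChange_lam_comp_eq_mulN {S' : Scheme.{u}} (g : S' ⟶ S) (pol : A.Polarization D) (d : ℕ) (ν : D.hat.X ⟶ A.X)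
    (hν : pol.lam ≫ ν = A.mulN d) :
    (pol.baseChange g).lam ≫ ((Over.pullback g).map ν : (D.hat.baseChange g).X ⟶ (A.baseChange g).X) = (A.baseChange g).mulN d := by
  rw [Polarization.baseChange_lam, ← A.baseChangeHom_mulN g d, ← hν]
  exact ((Over.pullback g).map_comp pol.lam ν).symm

/-- **(P-2) `[p^r] t = 1 ∧ λ t = 1 ⟹ t = 1` when `λ` is an isogeny of degree prime to `p`** (over a perfect field of characteristic `p`): ★ GEN leaf (o1)
`comp_lam_eq_one_imp_eq_one_of_coprime` on a torsion pin ★ `exists_torsionPin`, re-keyed to `A`-points. [cite: MumfordAV1970, §6 Application 3 (p. 64), §23]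
[cite: Tate1997FiniteFlatGroupSchemes, (3.7)] -/
theorem eq_one_of_comp_mulN_of_comp_lam_of_kerRank_coprime {k : Type u} [Field k] [PerfectField k] (p : ℕ) [Fact p.Prime] [CharP k p] (r : ℕ)
    (A : AbelianSchemeOver (Spec (.of k))) (D : A.DualPair) (pol : A.Polarization D)
    (hiso : haveI := pol.isMonHom
      IsIsogeny (homOfIsMonHom (A' := A) (B := D.hat) pol.lam))
    (hcop : haveI := pol.isMonHom
      (Hom.kerRank (homOfIsMonHom (A' := A) (B := D.hat) pol.lam)).Coprime p)
    ⦃T : SchemeOver k⦄ (t : T ⟶ A.X) (hN : t ≫ A.mulN (p ^ r) = 1) (hlam : t ≫ pol.lam = 1) : t = 1 := by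
  haveI := pol.isMonHom
  have hq : p ^ r ≠ 0 := pow_ne_zero r (Fact.out : p.Prime).ne_zero
  obtain ⟨G, _, _, _, _, _, j, _, _, hG⟩ := A.toAffine.toAbelianVariety.exists_torsionPin (N := p ^ r) hq
  rw [mulN_eq_zsmul_id] at hN
  obtain ⟨s, hs⟩ := (hG t).2 hN
  have hs1 : s = 1 :=
    comp_lam_eq_one_imp_eq_one_of_coprime p r A.toAffine.toAbelianVariety D pol.lam j hG hiso hcop s (by rw [hs]; exact hlam)
  rw [← hs, hs1, MonObj.one_comp]

end PrimeToP

/-! ## §3 THE HEAD: the package holds, from the RGD-side inputs only (at the point; §4 = the same after a base change to the point) -/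

-- budget: measured `#count_heartbeats` (`Elab.async false`): `WDockPackage` 13 414, `wDockPackage_of_line` 24 343 — no override (default 200 000).
/-- **HEAD `wDockPackage_of_line` (ED. 1) — SORRY-FREE.**  For an abelian scheme `A` over a perfect field `k` of characteristic `p` with a ring action
`act` of `O`, a dual pair `D`, a polarisation `pol`, a ring involution `star` (`hstar`) satisfying the ROSATI adjunction `ι(star a) ≫ λ = λ ≫ ι(a)^∨` (`hRos`,
the spine's `RGDInputsAt.rosati` read through `b' := star b`), `λ` injective on `A[q]` (`hlam`, in the `mulN` token), and `εu ∈ O` with `εu² = εu + q·c`: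
the `w`-block dock package holds.  Proof = the (α′) pins + the (α) layer calculus + ★ `dim_hat_eq` + ★ `Polarization.nonempty_unitHatSlice_iso`, then the
W-line AT `e₀` (`weilCartierDualityLagrangian_at`) fed into (BLF) (`blockLagrangianFrobenius_holds`) — junction v6, zero glue.
[cite: MumfordAV1970, §20 (I) (p. 186), §23] [cite: Oda1969, Cor. 1.3] [cite: Tate1967, §2.2] [cite: Tate1997FiniteFlatGroupSchemes, §(3.7)] -/
theorem wDockPackage_of_line {k : Type u} [Field k] [PerfectField k] (p r : ℕ) [Fact p.Prime] [CharP k p]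
    (A : AbelianSchemeOver (Spec (.of k))) (D : A.DualPair) (pol : A.Polarization D)
    {O : Type} [CommRing O] (star : O →+* O) (hstar : ∀ a, star (star a) = a) (act : A.RingAction O)
    (hRos : ∀ a, haveI := act.isMonHom_i a
      act.i (star a) ≫ pol.lam = pol.lam ≫ dualIsogenyOver (act.i a) D D)
    (hlam : ∀ ⦃T : SchemeOver k⦄ (t : T ⟶ A.X), t ≫ A.mulN (p ^ r) = 1 → t ≫ pol.lam = 1 → t = 1)
    (εu c : O) (he : εu * εu = εu + (p ^ r) • c) :
    WDockPackage k p r A D pol star act εu := by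
  have hp : p ≠ 0 := (Fact.out : p.Prime).ne_zero
  -- (0) the inputs read on the abelian variety `A' := A.toAffine.toAbelianVariety` (same carrier and group law; `dim Â = dim A` is inside the W-line ED. 3)
  have hD : Nonempty ((Scheme.Modules.pullback D.unitHatSlice).obj D.P ≅ SheafOfModules.unit _) :=
    pol.nonempty_unitHatSlice_iso
  -- (1) the pins (★ (α′)): `G = A[q]`, `Φ = G ∩ Ker F^{(r)}`, `Ĝ = Â[q]`
  obtain ⟨G, i1, i2, i3, i4, i5, j, i6, i7, hG, Φ, k1, k2, k3, k4, k5, φ, k6, k7, hΦ⟩ :=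
    A.toAffine.toAbelianVariety.exists_torsion_frobeniusKernel_pins p hp r
  obtain ⟨Ĝ, l1, l2, l3, l4, l5, ĵ, l6, l7, hĜ⟩ :=
    D.hat.toAffine.toAbelianVariety.exists_torsionPin (N := p ^ r) (pow_ne_zero r hp)
  haveI : Mono j := Over.mono_of_mono_left j
  -- (2) the layer action (★ (α) `exists_layerEnd_abelianVariety`) for `ι` read as endomorphisms of the abelian variety
  let act' : O → (A.toAffine.toAbelianVariety ⟶ A.toAffine.toAbelianVariety) := fun a =>
    haveI := act.isMonHom_i a
    homOfIsMonHom (act.i a)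
  have hact' : ∀ a, (act' a).hom.hom.hom = act.i a := fun a => rfl
  obtain ⟨β, hβm, hβ, hN⟩ := exists_layerEnd_abelianVariety A.toAffine.toAbelianVariety (p ^ r) G j hG act'
  haveI : ∀ a, IsMonHom (β a) := hβm
  have hβi : ∀ a, β a ≫ j = j ≫ act.i a := fun a => hβ a
  have hadd : ∀ a b, (act' (a + b)).hom.hom.hom = (act' a).hom.hom.hom * (act' b).hom.hom.hom := fun a b => by
    simp only [hact']
    exact act.i_add a b
  have hmul : ∀ a b, (act' (a * b)).hom.hom.hom = (act' b).hom.hom.hom ≫ (act' a).hom.hom.hom := fun a b => by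
    simp only [hact']
    exact act.i_mul a b
  have hβone : β 1 = 𝟙 G := layerEnd_one j (fun a => (act' a).hom.hom.hom) β hβ act.i_one
  have hβadd : ∀ a b : O, β (a + b) = β a * β b := fun a b =>
    layerEnd_add j (fun a => (act' a).hom.hom.hom) β hβ (hadd a b)
  have hβmul : ∀ a b : O, β (a * b) = β b ≫ β a := fun a b =>
    layerEnd_mul j (fun a => (act' a).hom.hom.hom) β hβ (hmul a b)
  -- the two idempotency facts (★ `layerEnd_idem_of_mul_self_eq`, ★ `mul_self_eq_add_nsmul_star`)
  have hidem𝒢 : β εu ≫ β εu = β εu := layerEnd_idem_of_mul_self_eq β hβadd hβmul hN he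
  have hidemW : β (star εu) ≫ β (star εu) = β (star εu) :=
    layerEnd_idem_of_mul_self_eq β hβadd hβmul hN (mul_self_eq_add_nsmul_star star he)
  -- (3) `λ` injective on the pin `G`, from `hlam` (the `mulN` token) and the pin reading `hG`
  have hlamG : ∀ ⦃T : SchemeOver k⦄ (t : T ⟶ G), (t ≫ j) ≫ pol.lam = 1 → t = 1 := by
    intro T t ht
    have hq : (t ≫ j) ≫ A.mulN (p ^ r) = 1 := by
      rw [mulN_eq_zsmul_id]
      exact (hG (t ≫ j)).1 ⟨t, rfl⟩
    have h1 : t ≫ j = (1 : T ⟶ G) ≫ j := by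
      rw [MonObj.one_comp]
      exact hlam (t ≫ j) hq ht
    exact (cancel_mono j).1 h1
  -- the Rosati adjunction read on `act'`
  have hRos' : ∀ a, (act' (star a)).hom.hom.hom ≫ pol.lam =
      pol.lam ≫ dualIsogenyOver (A' := (AbelianScheme.ofAbelianVariety A.toAffine.toAbelianVariety).toOver)
        (B := (AbelianScheme.ofAbelianVariety A.toAffine.toAbelianVariety).toOver) (act' a).hom.hom.hom D D := fun a => hRos a
  -- (4) the fixed layers `W = Fix β(ε̄)`, `𝒢l = Fix β(εu)` (★ `exists_fixedLayer`) and the sublayer `Φ𝒢 = 𝒢l ∩ Ker F` (★ `exists_interLayer_of_reading`)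
  obtain ⟨W, iW1, iW2, iW3, iW4, iW5, jW, iW6, iW7, hW⟩ := exists_fixedLayer G (β (star εu))
  obtain ⟨𝒢l, i𝒢1, i𝒢2, i𝒢3, i𝒢4, i𝒢5, j𝒢, i𝒢6, i𝒢7, h𝒢⟩ := exists_fixedLayer G (β εu)
  obtain ⟨Φ𝒢, iΦ1, iΦ2, iΦ3, iΦ4, iΦ5, φ𝒢, iΦ6, iΦ7, hΦ𝒢⟩ :=
    exists_interLayer_of_reading 𝒢l j𝒢 (j ≫ (A.toAffine.toAbelianVariety.relFrobenius p r).hom.hom.hom) φ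
      (fun T t => by simpa only [Category.assoc] using hΦ t)
  have hΦ𝒢' : ∀ ⦃T : SchemeOver k⦄ (y : T ⟶ 𝒢l),
      (∃ s : T ⟶ Φ𝒢, s ≫ φ𝒢 = y) ↔ ((y ≫ j𝒢) ≫ j) ≫ (A.toAffine.toAbelianVariety.relFrobenius p r).hom.hom.hom = 1 :=
    fun T y => (hΦ𝒢 y).trans (hΦ (y ≫ j𝒢))
  -- (5) the W-line AT `e₀` (three head properties), then (BLF) at that `e₀` — junction v6, zero glue
  obtain ⟨he₀, hherm, hlag⟩ := weilCartierDualityLagrangian_at p r A.toAffine.toAbelianVariety D pol j hG ĵ hĜ hD hlamG φ hΦ O star act' β hβ hRos'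
  obtain ⟨eW, heW, hdock, hlaw⟩ := blockLagrangianFrobenius_holds p r A.toAffine.toAbelianVariety G j hG Φ φ hΦ O star act' β hβ
    (e₀ p r A.toAffine.toAbelianVariety D pol j hG ĵ hĜ hlamG) he₀ hherm hlag εu (star εu) rfl (hstar εu) hidemW hidem𝒢
    W jW hW 𝒢l j𝒢 h𝒢 Φ𝒢 φ𝒢 hΦ𝒢
  exact ⟨G, i1, i2, i3, i4, i5, j, i6, i7, hG, Φ, k1, k2, k3, k4, k5, φ, k6, k7, hΦ, Ĝ, l1, l2, l3, l4, l5, ĵ, l6, l7, hĜ, β, hβm, hβi,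
    hβone, hβadd, hβmul, hN, hidem𝒢, hidemW, hlamG,
    W, iW1, iW2, iW3, iW4, iW5, jW, iW6, iW7, hW, 𝒢l, i𝒢1, i𝒢2, i𝒢3, i𝒢4, i𝒢5, j𝒢, i𝒢6, i𝒢7, h𝒢,
    Φ𝒢, iΦ1, iΦ2, iΦ3, iΦ4, iΦ5, φ𝒢, iΦ6, iΦ7, hΦ𝒢', eW, heW, he₀, hherm, hlag, hdock, hlaw⟩

end Summit.HodgeConjecture.HodgeConjecture.Cruxes.HLiu418.F0P6bWDock

end
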